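import Mathlib
import Summits.MatrixMultiplication.MatrixMultiplication.Theorems.LevelGradedCohnUmansLieRankDesignsStubRankSepOfFreeFrames
import Summits.MatrixMultiplication.MatrixMultiplication.Theorems.LevelGradedCohnUmansLieRankDesignsStubLevelOfFixedVector

/-!
# Borel subsets of `GL₂(𝔽_p)` missing one unipotent pass the level-`1` identity test
(positive instance lemma for the identity-design clause of the crux `SubgroupIdentityDesigns`,
stmt-MatrixMultiplication-14079; cell B2b-5, gen 6 — THEOREM H, corollary H1)

Level `1` on `GL₂(𝔽_p)`: `f = Σ_{rk M ≤ 1} c_M ψ(tr(M·))` (`fourierFn`, `RankSupp 1`).  The identity TEST on a set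
`S` asks for such an `f` with `f(1) = 1` and `f(s) = 0` for `s ∈ S ∖ {1}`; the identity-DESIGN clause of the crux is
the test on `S = H₁H₂H₃`.  Gen 5 of the cell certified (exact arithmetic in `ℚ(ζ₁₁)`, 900 points) the first
subgroup triple of `GL₂(𝔽₁₁)` above the counting floor `(p+1)³` passing the level-`1` test; its three subgroups
share an eigenline, i.e. `H₁H₂H₃` lies in a Borel subgroup.  This file proves the general reason:

* `borelTestFn y₀` — for `y₀ ≠ 0` the level-`1` function
  `f(g) = p⁻¹ Σ_{u ∈ 𝔽_p} ([g (u,1)ᵀ = (u,1)ᵀ] − [g (u,1)ᵀ = (u + y₀, 1)ᵀ])`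
  (a signed average of `2p` FRAME INDICATORS `[g U₀ = W₀]`, `U₀, W₀ ∈ M_{2×1}(𝔽_p)`, each of level `1` by the
  landed frame duality `LieRankDesigns.FreeFrame.exists_frameIndicatorCoeff`; `F_1` is a linear subspace,
  `LieRankDesigns.LevelOfFixedVector.{smul,sum}_mem_levelSet`).
* `borelTestFn_one`, `borelTestFn_eq_zero` — `f(1) = 1`, and `f(s) = 0` for every UPPER TRIANGULAR `s ≠ 1` other
  than the unipotent `u(y₀) = [[1, y₀], [0, 1]]`: for `s = [[x, y], [0, z]]` one has `s (u,1)ᵀ = (xu + y, z)ᵀ`, so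
  both indicators vanish unless `z = 1`; if `x ≠ 1` each of the two equations `xu + y = u`, `xu + y = u + y₀` has
  exactly one solution `u`, and if `x = 1` neither has one (`y ≠ 0, y₀`).
* `idTest_of_borel_missingUnipotent` — COROLLARY H1: every set `S` of upper triangular elements of `GL₂(𝔽_p)` that
  misses some unipotent `u(y₀)`, `y₀ ≠ 0`, passes the level-`1` identity test.
* `levelOne_idDesign_of_borel` — the crux-language instance: subgroups `H₁, H₂, H₃` of the upper Borel with
  `u(y₀) ∉ H₁H₂H₃` for some `y₀ ≠ 0` admit a level-`1` identity design (the literal second clause of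
  `SubgroupIdentityDesigns` at `m = 2`, `k = 1`).  By conjugation the same holds in any Borel.
Context (cell report `run/shared/lean/b2b/levelgraded-cu/ORACLE-g6.md`, THEOREM H): for `S ⊆ B` the annihilator of
`F_1|_S` is the cycle space of the bipartite graph of FULL unipotent cosets inside `S`, so `S` passes iff the coset
`U = {u(y)}` is not inside `S` (this file) or is a bridge of that graph; the `4`-cycle case of the converse is
`Negative.TorusCube` (`k = 1`, `m = 2`).  Consequence for the programme: Borel triples pass generically, but their
volume is `≤ (p−1)⁴`, so they certify the crux only for `ε ≳ 18` (census in ORACLE-g6) — never `ω < 3`.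
Sorry-free; standard axioms.  VALUE = a theorem about one test family, NOT summit progress; the crux item stays open.
-/

set_option linter.dupNamespace false

noncomputable section

open scoped BigOperators Classical
open Summit.MatrixMultiplication.MatrixMultiplication.Theorems.LieRankDesigns.Negative
  (GLm Mat fourierFn RankSupp levelSet)
open Summit.MatrixMultiplication.MatrixMultiplication.Theorems.LieRankDesigns.FreeFrame (exists_frameIndicatorCoeff)
open Summit.MatrixMultiplication.MatrixMultiplication.Theorems.LieRankDesigns.LevelOfFixedVector
  (add_mem_levelSet smul_mem_levelSet sum_mem_levelSet)

namespace Summit.MatrixMultiplication.MatrixMultiplication.Theorems.SubgroupIdentityDesigns.Negative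

variable {p : ℕ} [Fact p.Prime]

/-! ### Level-`k` functions: frame indicators and differences -/

/-- A frame indicator `g ↦ [g U₀ = W₀]` is a level-`k` function (restates `exists_frameIndicatorCoeff`). -/
theorem frameIndicator_mem_levelSet {m k : ℕ} (U₀ W₀ : Matrix (Fin m) (Fin k) (ZMod p)) :
    (fun g : GLm p m => if (g : Mat p m) * U₀ = W₀ then (1 : ℂ) else 0) ∈ levelSet p m k := by
  obtain ⟨c, hc, hcf⟩ := exists_frameIndicatorCoeff (p := p) U₀ W₀
  exact ⟨c, hc, fun g => (hcf g).symm⟩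

/-- `F_k` is closed under differences. -/
theorem sub_mem_levelSet {m k : ℕ} {f₁ f₂ : GLm p m → ℂ} (h₁ : f₁ ∈ levelSet p m k)
    (h₂ : f₂ ∈ levelSet p m k) : (fun g => f₁ g - f₂ g) ∈ levelSet p m k := by
  obtain ⟨c₁, hc₁, hf₁⟩ := h₁
  obtain ⟨c₂, hc₂, hf₂⟩ := h₂
  refine ⟨c₁ - c₂, fun M hM => ?_, fun g => ?_⟩
  · simp only [Pi.sub_apply, hc₁ M hM, hc₂ M hM, sub_zero]
  · simp only [fourierFn, Pi.sub_apply, hf₁ g, hf₂ g, sub_mul, Finset.sum_sub_distrib]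

/-! ### The affine frames `(u, 1)ᵀ` and upper triangular matrices -/

/-- The column `(u, 1)ᵀ ∈ M_{2×1}(𝔽_p)` (an affine point of the projective line). -/
def affCol (u : ZMod p) : Matrix (Fin 2) (Fin 1) (ZMod p) := !![u; 1]

/-- The top entry of `(u, 1)ᵀ` is `u`. -/
@[simp] theorem affCol_zero (u : ZMod p) : affCol u 0 0 = u := rfl

/-- The bottom entry of `(u, 1)ᵀ` is `1`. -/
@[simp] theorem affCol_one (u : ZMod p) : affCol u 1 0 = 1 := rfl

/-- For upper triangular `s = [[x, y], [0, z]]`: `s (u,1)ᵀ = (v,1)ᵀ ↔ xu + y = v ∧ z = 1`. -/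
theorem mul_affCol_eq_affCol_iff (s : Mat p 2) (hs : s 1 0 = 0) (u v : ZMod p) :
    s * affCol u = affCol v ↔ s 0 0 * u + s 0 1 = v ∧ s 1 1 = 1 := by
  have e0 : (s * affCol u) 0 0 = s 0 0 * u + s 0 1 := by
    simp [Matrix.mul_apply, Fin.sum_univ_two]
  have e1 : (s * affCol u) 1 0 = s 1 1 := by
    simp [Matrix.mul_apply, Fin.sum_univ_two, hs]
  constructor
  · intro h
    exact ⟨by rw [← e0, h, affCol_zero], by rw [← e1, h, affCol_one]⟩
  · rintro ⟨h0, h1⟩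
    ext i j
    fin_cases i <;> fin_cases j
    · simpa [e0] using h0
    · simpa [e1] using h1

/-- The product of two upper triangular elements of `GL₂` is upper triangular. -/
theorem upper_mul {a b : GLm p 2} (ha : (a : Mat p 2) 1 0 = 0) (hb : (b : Mat p 2) 1 0 = 0) :
    ((a * b : GLm p 2) : Mat p 2) 1 0 = 0 := by
  rw [Units.val_mul, Matrix.mul_apply, Fin.sum_univ_two, ha, hb, zero_mul, mul_zero, add_zero]

/-- An upper triangular element of `GL₂` with `x = z = 1` and `y = 0` is `1`. -/
theorem eq_one_of_entries (s : GLm p 2) (hs : (s : Mat p 2) 1 0 = 0) (hx : (s : Mat p 2) 0 0 = 1)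
    (hy : (s : Mat p 2) 0 1 = 0) (hz : (s : Mat p 2) 1 1 = 1) : s = 1 := by
  apply Units.ext
  ext i j
  fin_cases i <;> fin_cases j
  · simpa using hx
  · simpa using hy
  · simpa using hs
  · simpa using hz

/-- The upper unipotent `u(y) = [[1, y], [0, 1]] ∈ GL₂(𝔽_p)`. -/
def unipUpper (y : ZMod p) : GLm p 2 :=
  ⟨!![1, y; 0, 1], !![1, -y; 0, 1],
    by simp [Matrix.one_fin_two],
    by simp [Matrix.one_fin_two]⟩

/-- Entries characterise `u(y)` among upper triangular elements. -/
theorem eq_unipUpper_of_entries (s : GLm p 2) (hs : (s : Mat p 2) 1 0 = 0) {y : ZMod p}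
    (hx : (s : Mat p 2) 0 0 = 1) (hy : (s : Mat p 2) 0 1 = y) (hz : (s : Mat p 2) 1 1 = 1) :
    s = unipUpper y := by
  apply Units.ext
  ext i j
  fin_cases i <;> fin_cases j
  · simpa [unipUpper] using hx
  · simpa [unipUpper] using hy
  · simpa [unipUpper] using hs
  · simpa [unipUpper] using hz

/-! ### The Borel test function -/

/-- The Borel test function `f_{y₀}(g) = p⁻¹ Σ_u ([g (u,1)ᵀ = (u,1)ᵀ] − [g (u,1)ᵀ = (u + y₀, 1)ᵀ])`. -/
def borelTestFn (y₀ : ZMod p) (g : GLm p 2) : ℂ :=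
  (p : ℂ)⁻¹ * ∑ u : ZMod p, ((if (g : Mat p 2) * affCol u = affCol u then (1 : ℂ) else 0)
      - (if (g : Mat p 2) * affCol u = affCol (u + y₀) then (1 : ℂ) else 0))

/-- `f_{y₀}` is a level-`1` function: a linear combination of frame indicators. -/
theorem borelTestFn_mem_levelSet (y₀ : ZMod p) : borelTestFn y₀ ∈ levelSet p 2 1 := by
  have h : ∀ u ∈ (Finset.univ : Finset (ZMod p)),
      (fun g : GLm p 2 => (fun g : GLm p 2 => if (g : Mat p 2) * affCol u = affCol u then (1 : ℂ) else 0) g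
        - (fun g : GLm p 2 => if (g : Mat p 2) * affCol u = affCol (u + y₀) then (1 : ℂ) else 0) g)
        ∈ levelSet p 2 1 :=
    fun u _ => sub_mem_levelSet (frameIndicator_mem_levelSet (affCol u) (affCol u))
      (frameIndicator_mem_levelSet (affCol u) (affCol (u + y₀)))
  exact smul_mem_levelSet (sum_mem_levelSet Finset.univ _ h) _

/-- `f_{y₀}(1) = 1` (each of the `p` summands is `1 − 0`). -/
theorem borelTestFn_one {y₀ : ZMod p} (hy₀ : y₀ ≠ 0) : borelTestFn y₀ 1 = 1 := by
  have hp : (p : ℂ) ≠ 0 := Nat.cast_ne_zero.mpr (Fact.out : p.Prime).ne_zero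
  have h1 : ∀ u : ZMod p, ((1 : GLm p 2) : Mat p 2) * affCol u = affCol u := fun u => by
    rw [Units.val_one, Matrix.one_mul]
  have h2 : ∀ u : ZMod p, ((1 : GLm p 2) : Mat p 2) * affCol u ≠ affCol (u + y₀) := fun u h => by
    rw [Units.val_one, Matrix.one_mul] at h
    have h00 : affCol u 0 0 = affCol (u + y₀) 0 0 := by rw [h]
    rw [affCol_zero, affCol_zero] at h00
    exact hy₀ (by simpa using h00.symm)
  unfold borelTestFn
  simp_rw [if_pos (h1 _), if_neg (h2 _), sub_zero, Finset.sum_const, Finset.card_univ, ZMod.card,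
    nsmul_eq_mul, mul_one]
  exact inv_mul_cancel₀ hp

/-- `f_{y₀}(s) = 0` for upper triangular `s ≠ 1, u(y₀)` (given by entries). -/
theorem borelTestFn_eq_zero (y₀ : ZMod p) (s : GLm p 2) (hs : (s : Mat p 2) 1 0 = 0) (hs1 : s ≠ 1)
    (hmiss : ¬ ((s : Mat p 2) 0 0 = 1 ∧ (s : Mat p 2) 0 1 = y₀ ∧ (s : Mat p 2) 1 1 = 1)) :
    borelTestFn y₀ s = 0 := by
  unfold borelTestFn
  simp_rw [mul_affCol_eq_affCol_iff _ hs]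
  refine mul_eq_zero_of_right _ ?_
  by_cases hz : (s : Mat p 2) 1 1 = 1
  · by_cases hx : (s : Mat p 2) 0 0 = 1
    · -- `s` unipotent: `y ≠ 0` (as `s ≠ 1`) and `y ≠ y₀` (as `s ≠ u(y₀)`): every summand is `0 − 0`
      have hy : (s : Mat p 2) 0 1 ≠ 0 := fun hy => hs1 (eq_one_of_entries s hs hx hy hz)
      have hyy : (s : Mat p 2) 0 1 ≠ y₀ := fun h => hmiss ⟨hx, h, hz⟩
      refine Finset.sum_eq_zero fun u _ => ?_
      rw [hx, one_mul, if_neg, if_neg, sub_zero]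
      · rintro ⟨h, -⟩
        exact hyy (add_left_cancel h)
      · rintro ⟨h, -⟩
        exact hy (by simpa using h)
    · -- `x ≠ 1`: each of the two equations has exactly one solution `u`
      have h1x : (1 : ZMod p) - (s : Mat p 2) 0 0 ≠ 0 := sub_ne_zero.mpr (Ne.symm hx)
      have key : ∀ v u : ZMod p,
          ((s : Mat p 2) 0 0 * u + (s : Mat p 2) 0 1 = u + v ∧ (s : Mat p 2) 1 1 = 1) ↔
            u = ((s : Mat p 2) 0 1 - v) / (1 - (s : Mat p 2) 0 0) := by
        intro v u
        rw [and_iff_left hz, eq_div_iff h1x]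
        constructor
        · intro h; linear_combination (-1 : ZMod p) * h
        · intro h; linear_combination (-1 : ZMod p) * h
      have key0 : ∀ u : ZMod p,
          ((s : Mat p 2) 0 0 * u + (s : Mat p 2) 0 1 = u ∧ (s : Mat p 2) 1 1 = 1) ↔
            u = ((s : Mat p 2) 0 1 - 0) / (1 - (s : Mat p 2) 0 0) := fun u => by
        simpa using key 0 u
      simp_rw [key0, key, Finset.sum_sub_distrib, Finset.sum_ite_eq', Finset.mem_univ, if_true, sub_self]
  · refine Finset.sum_eq_zero fun u _ => ?_
    rw [if_neg fun h => hz h.2, if_neg fun h => hz h.2, sub_zero]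

/-! ### Corollary H1 and the crux-language instance -/

/-- **COROLLARY H1.**  Every set `S` of upper triangular elements of `GL₂(𝔽_p)` missing some unipotent
`u(y₀) = [[1, y₀], [0, 1]]`, `y₀ ≠ 0` (stated by entries), passes the level-`1` identity test: there is a
rank-`≤ 1`-supported table `c` with `Σ_M c_M ψ(tr M) = 1` and `Σ_M c_M ψ(tr(M s)) = 0` for all `s ∈ S ∖ {1}`. -/
theorem idTest_of_borel_missingUnipotent (S : Set (GLm p 2)) (hS : ∀ s ∈ S, (s : Mat p 2) 1 0 = 0)
    {y₀ : ZMod p} (hy₀ : y₀ ≠ 0)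
    (hmiss : ∀ s ∈ S, ¬ ((s : Mat p 2) 0 0 = 1 ∧ (s : Mat p 2) 0 1 = y₀ ∧ (s : Mat p 2) 1 1 = 1)) :
    ∃ c : Mat p 2 → ℂ, RankSupp 1 c ∧ fourierFn c 1 = 1 ∧ ∀ s ∈ S, s ≠ 1 → fourierFn c s = 0 := by
  obtain ⟨c, hc, hcf⟩ := borelTestFn_mem_levelSet (p := p) y₀
  refine ⟨c, hc, ?_, fun s hs hs1 => ?_⟩
  · rw [← hcf]
    exact borelTestFn_one hy₀
  · rw [← hcf]
    exact borelTestFn_eq_zero y₀ s (hS s hs) hs1 (hmiss s hs)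

/-- The same with the missing unipotent given as an element: `u(y₀) ∉ S`. -/
theorem idTest_of_borel_not_mem (S : Set (GLm p 2)) (hS : ∀ s ∈ S, (s : Mat p 2) 1 0 = 0)
    {y₀ : ZMod p} (hy₀ : y₀ ≠ 0) (hmiss : unipUpper y₀ ∉ S) :
    ∃ c : Mat p 2 → ℂ, RankSupp 1 c ∧ fourierFn c 1 = 1 ∧ ∀ s ∈ S, s ≠ 1 → fourierFn c s = 0 :=
  idTest_of_borel_missingUnipotent S hS hy₀ fun s hs h =>
    hmiss ((eq_unipUpper_of_entries s (hS s hs) h.1 h.2.1 h.2.2) ▸ hs)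

/-- **The identity-design clause of the crux HOLDS for Borel triples missing a unipotent** (`m = 2`, `k = 1`), in
the literal shape of the second clause of `SubgroupIdentityDesigns`: if `H₁, H₂, H₃ ≤ GL₂(𝔽_p)` are upper
triangular and some `u(y₀)`, `y₀ ≠ 0`, is not of the form `a b g` (`a ∈ H₁, b ∈ H₂, g ∈ H₃`), then there is `c`
with `c_M = 0` for `rk M > 1`, `Σ_M c_M ψ(tr(M·1)) = 1` and `Σ_M c_M ψ(tr(M·abg)) = 0` whenever `a b g ≠ 1`. -/
theorem levelOne_idDesign_of_borel
    {H₁ H₂ H₃ : Subgroup (Matrix.GeneralLinearGroup (Fin 2) (ZMod p))}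
    (h₁ : ∀ a ∈ H₁, (a : Mat p 2) 1 0 = 0) (h₂ : ∀ b ∈ H₂, (b : Mat p 2) 1 0 = 0)
    (h₃ : ∀ g ∈ H₃, (g : Mat p 2) 1 0 = 0) {y₀ : ZMod p} (hy₀ : y₀ ≠ 0)
    (hmiss : ∀ a ∈ H₁, ∀ b ∈ H₂, ∀ g ∈ H₃, a * b * g ≠ unipUpper y₀) :
    ∃ c : Mat p 2 → ℂ, (∀ M : Mat p 2, 1 < M.rank → c M = 0) ∧
      (∑ M : Mat p 2, c M * ZMod.stdAddChar (Matrix.trace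
        (M * ((1 : Matrix.GeneralLinearGroup (Fin 2) (ZMod p)) : Mat p 2)))) = 1 ∧
      ∀ a ∈ H₁, ∀ b ∈ H₂, ∀ g ∈ H₃, a * b * g ≠ 1 →
        (∑ M : Mat p 2, c M * ZMod.stdAddChar (Matrix.trace
          (M * ((a * b * g : Matrix.GeneralLinearGroup (Fin 2) (ZMod p)) : Mat p 2)))) = 0 := by
  let S : Set (GLm p 2) := {s | ∃ a ∈ H₁, ∃ b ∈ H₂, ∃ g ∈ H₃, s = a * b * g}
  have hS : ∀ s ∈ S, (s : Mat p 2) 1 0 = 0 := by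
    rintro s ⟨a, ha, b, hb, g, hg, rfl⟩
    exact upper_mul (upper_mul (h₁ a ha) (h₂ b hb)) (h₃ g hg)
  have hmissS : unipUpper y₀ ∉ S := by
    rintro ⟨a, ha, b, hb, g, hg, h⟩
    exact hmiss a ha b hb g hg h.symm
  obtain ⟨c, hc, hc1, hc0⟩ := idTest_of_borel_not_mem S hS hy₀ hmissS
  refine ⟨c, hc, ?_, fun a ha b hb g hg hne => ?_⟩
  · simpa [fourierFn] using hc1
  · simpa [fourierFn] using hc0 (a * b * g) ⟨a, ha, b, hb, g, hg, rfl⟩ hne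

end Summit.MatrixMultiplication.MatrixMultiplication.Theorems.SubgroupIdentityDesigns.Negative

end
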